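import Summits.QuantumFields.YangMills.Theorems.LuscherReductionTwistedTraceScalingToronSymmetricFunctional
import HarnessLib

/-!
# C4 INNER, brick Y: COLOUR-ROTATION SYMMETRY KILLS THE FIRST ORDER — Ad-invariant linear functionals on colour multiplets vanish; equivariant
# first-order perturbations have zero trace; `log det(1 + N)` is second order when `tr N = 0`
# (lane A of S-BASE, crux `TwistedTraceScaling` stmt-QuantumFields-20203; sub-target C4, design note `pub/ym-fleet/ym-luscher-20007-p1/COARSE-DESIGN.md` §21.2, §21.5 Y)

The Born–Oppenheimer package `InnerBOPackageAt` (`…InnerBOPackage`) needs the diagonal block `K_eff(c,c')` of the lattice kernel at relative precision `o(λ_b)`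
although the slow–stiff coupling `β·H₁(c)(q,q)` is first order (`β^{−1/4}`) pointwise.  The coupling is quadratic in the fluctuations and linear in the slow
coordinate `c ∈ su(2)³`, so it is absorbed into a `c`-dependent Gaussian whose integral is a determinant `det(𝔸₀ + 𝔹₁(c))^{−1/2}`; in coordinates normalising the
vacuum form (`𝔸₀ = 1`) the relative factor is `det(1 + N(c))^{−1/2}` with `N` linear in `c` and EQUIVARIANT under the constant gauge transformations (colour rotations
`Ad(V)`, `V ∈ SU(2)`), which commute with the vacuum data.  This file supplies the three abstract facts that make the factor second order:
* §1 `exists_adRot_halfTurn_two` (the half-turn about the second colour axis: `Ad(j) = diag(−1,1,−1)`; with the tree's `adRot_diagSU2_halfTurn_mulVec`, `diag(1,−1,−1)`), and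
  ★ `colourFunctional_eq_zero_of_halfTurns` / `colourFunctional_eq_zero_of_adRot` — a linear functional on colour multiplets `c : ι → ℝ³` invariant under the two
  simultaneous half-turns (a fortiori under all `Ad(V)`) VANISHES (`so(3)` acts on `ℝ³` without invariant vectors);
* §2 ★ `trace_comp_equivariant_eq_zero` — if `T` commutes with an action `ρ` and `B` is linear and `ρ`-equivariant over an action `α` on the parameters, then
  `c ↦ tr(T ∘ B c)` is `α`-invariant (`trace_conj'`), hence zero whenever invariant functionals vanish;
* §3 ★★ `log_det_one_add_two_sided` / `abs_log_det_one_add_le_of_trace_eq_zero` — for a real symmetric `N` with `|⟨v,Nv⟩| ≤ κ‖v‖²`, `κ ≤ ½`: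
  `0 < det(1+N)` and `tr N − 2|m|κ² ≤ log det(1+N) ≤ tr N`, from `1 − 1/μ ≤ log μ ≤ μ − 1` on the eigenvalues of `1+N`.  With `tr N = 0`:
  `|log det(1+N)| ≤ 2|m|κ²` — the SECOND-ORDER factor of §21.2;
* §4 ★★ `abs_log_det_add_sub_log_det_le` — the congruence form used downstream: `D = diag d > 0`, `|vᵀBv| ≤ ε vᵀDv`, `Σ Bᵢᵢ/dᵢ = 0` ⇒
  `|log det(D+B) − log det D| ≤ 2|m|ε²` (normalise `N = D^{−1/2}BD^{−1/2}`).
HONEST FRAMING: finite-dimensional linear algebra for a stub of a child of the CONDITIONAL reduction route (femto rung R2b1); not infinite volume, not a gap, not Clay.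

## References
* M. Lüscher, Nucl. Phys. B219 (1983) 233, §3 (the constant-mode reduction; global colour rotations). [Luscher1983]
* R. A. Horn, C. R. Johnson, *Matrix Analysis* (2nd ed., 2013), Thm 4.1.5 (spectral theorem), §7.8 (determinantal inequalities). [HornJohnson2013]
-/

set_option autoImplicit false

noncomputable section

open Finset Module
open scoped BigOperators Matrix ComplexConjugate
open Literature.MathematicalPhysics.QuantumFieldTheory
open Literature.MathematicalPhysics.QuantumLattice

namespace Summit.QuantumFields.YangMills.Theorems.FemtoTransferGap.TwoLattice.Toron

open Summit.QuantumFields.YangMills.Theorems.FemtoTransferGap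

/-! ## §1 Colour half-turns and invariant linear functionals -/

/-- There is `V ∈ SU(2)` (the unit quaternion `j = [[0,1],[−1,0]]`) with `Ad(V) = diag(−1, 1, −1)`: the half-turn about the second colour axis.
[cite: BrockerTomDieck1985, I (1.10)] -/
theorem exists_adRot_halfTurn_two : ∃ V : SU2, ∀ v : Fin 3 → ℝ, (adRot V).mulVec v = ![-v 0, v 1, -v 2] := by
  have hmem : (!![0, 1; -1, 0] : Matrix (Fin 2) (Fin 2) ℂ) ∈ Matrix.specialUnitaryGroup (Fin 2) ℂ := by
    rw [Matrix.mem_specialUnitaryGroup_iff, Matrix.mem_unitaryGroup_iff]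
    refine ⟨?_, ?_⟩
    · ext i j
      fin_cases i <;> fin_cases j <;>
        simp [Matrix.mul_apply, Fin.sum_univ_two, Matrix.star_eq_conjTranspose, Matrix.conjTranspose_apply]
    · simp [Matrix.det_fin_two_of]
  refine ⟨⟨!![0, 1; -1, 0], hmem⟩, fun v => ?_⟩
  unfold adRot
  simp only [Matrix.of_apply, Matrix.cons_val', Matrix.cons_val_zero, Matrix.cons_val_one, Matrix.cons_val_fin_one,
    Matrix.empty_val', Complex.zero_re, Complex.zero_im, Complex.one_re, Complex.one_im]
  ext a
  fin_cases a <;> simp [Matrix.mulVec, dotProduct, Fin.sum_univ_three]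

variable {ι : Type*}

/-- ★ **Invariant colour functionals vanish.**  A linear functional on colour multiplets `c : ι → ℝ³` that is invariant under the two simultaneous half-turns
`diag(1,−1,−1)` and `diag(−1,1,−1)` is zero. [cite: Luscher1983, §3] -/
theorem colourFunctional_eq_zero_of_halfTurns (ℓ : (ι → Fin 3 → ℝ) →ₗ[ℝ] ℝ)
    (h1 : ∀ c : ι → Fin 3 → ℝ, ℓ (fun i => ![c i 0, -c i 1, -c i 2]) = ℓ c)
    (h2 : ∀ c : ι → Fin 3 → ℝ, ℓ (fun i => ![-c i 0, c i 1, -c i 2]) = ℓ c) : ℓ = 0 := by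
  -- split `c = c₀ + c₁ + c₂` by colour component; each piece is negated by one of the half-turns (or their product)
  ext c
  set p0 : ι → Fin 3 → ℝ := fun i => ![c i 0, 0, 0] with hp0
  set p1 : ι → Fin 3 → ℝ := fun i => ![0, c i 1, 0] with hp1
  set p2 : ι → Fin 3 → ℝ := fun i => ![0, 0, c i 2] with hp2
  have hc : c = p0 + p1 + p2 := by
    funext i a
    fin_cases a <;> simp [hp0, hp1, hp2]
  -- `ℓ p1 = 0`: the first half-turn negates `p1`
  have e1 : (fun i => ![p1 i 0, -p1 i 1, -p1 i 2]) = -p1 := by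
    funext i a; fin_cases a <;> simp [hp1]
  have l1 : ℓ p1 = 0 := by
    have := h1 p1
    rw [e1, map_neg] at this
    linarith
  -- `ℓ p0 = 0`: the second half-turn negates `p0`
  have e0 : (fun i => ![-p0 i 0, p0 i 1, -p0 i 2]) = -p0 := by
    funext i a; fin_cases a <;> simp [hp0]
  have l0 : ℓ p0 = 0 := by
    have := h2 p0
    rw [e0, map_neg] at this
    linarith
  -- `ℓ p2 = 0`: either half-turn negates `p2`
  have e2 : (fun i => ![p2 i 0, -p2 i 1, -p2 i 2]) = -p2 := by
    funext i a; fin_cases a <;> simp [hp2]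
  have l2 : ℓ p2 = 0 := by
    have := h1 p2
    rw [e2, map_neg] at this
    linarith
  rw [hc, map_add, map_add, l0, l1, l2, LinearMap.zero_apply]
  ring

/-- ★ **`Ad`-invariant colour functionals vanish**: a linear functional on `ι → ℝ³` invariant under ALL simultaneous colour rotations `cᵢ ↦ Ad(V)cᵢ`, `V ∈ SU(2)`,
is zero (the two half-turns `Ad(diagSU2(π/2))`, `Ad(j)` suffice). [cite: Luscher1983, §3] -/
theorem colourFunctional_eq_zero_of_adRot (ℓ : (ι → Fin 3 → ℝ) →ₗ[ℝ] ℝ)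
    (h : ∀ (V : SU2) (c : ι → Fin 3 → ℝ), ℓ (fun i => (adRot V).mulVec (c i)) = ℓ c) : ℓ = 0 := by
  refine colourFunctional_eq_zero_of_halfTurns ℓ (fun c => ?_) (fun c => ?_)
  · have := h (diagSU2 (Real.pi / 2)) c
    simp_rw [adRot_diagSU2_halfTurn_mulVec] at this
    exact this
  · obtain ⟨V, hV⟩ := exists_adRot_halfTurn_two
    have := h V c
    simp_rw [hV] at this
    exact this

/-- Pointwise form: every value of an `Ad`-invariant colour functional is `0`. [cite: Luscher1983, §3] -/
theorem colourFunctional_apply_eq_zero_of_adRot (ℓ : (ι → Fin 3 → ℝ) →ₗ[ℝ] ℝ)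
    (h : ∀ (V : SU2) (c : ι → Fin 3 → ℝ), ℓ (fun i => (adRot V).mulVec (c i)) = ℓ c) (c : ι → Fin 3 → ℝ) : ℓ c = 0 := by
  rw [colourFunctional_eq_zero_of_adRot ℓ h, LinearMap.zero_apply]

/-! ## §2 Equivariant first-order perturbations have zero trace -/

section Trace

variable {C F G : Type*} [AddCommGroup C] [Module ℝ C] [AddCommGroup F] [Module ℝ F]

/-- ★ **The trace of an equivariant perturbation is an invariant functional.**  If `T` commutes with every `ρ g` and `B (α g c) = ρ g ∘ B c ∘ (ρ g)⁻¹`, then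
`tr(T ∘ B (α g c)) = tr(T ∘ B c)`. [cite: HornJohnson2013, Thm 4.1.5] -/
theorem trace_comp_equivariant_invariant (α : G → C →ₗ[ℝ] C) (ρ : G → F ≃ₗ[ℝ] F) (T : F →ₗ[ℝ] F) (B : C →ₗ[ℝ] F →ₗ[ℝ] F)
    (hT : ∀ g, T ∘ₗ (ρ g : F →ₗ[ℝ] F) = (ρ g : F →ₗ[ℝ] F) ∘ₗ T)
    (hB : ∀ g c, B (α g c) = (ρ g : F →ₗ[ℝ] F) ∘ₗ B c ∘ₗ ((ρ g).symm : F →ₗ[ℝ] F)) (g : G) (c : C) :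
    LinearMap.trace ℝ F (T ∘ₗ B (α g c)) = LinearMap.trace ℝ F (T ∘ₗ B c) := by
  rw [hB g c]
  have e : T ∘ₗ ((ρ g : F →ₗ[ℝ] F) ∘ₗ B c ∘ₗ ((ρ g).symm : F →ₗ[ℝ] F)) = (ρ g).conj (T ∘ₗ B c) := by
    rw [LinearEquiv.conj_apply, ← LinearMap.comp_assoc, hT g, LinearMap.comp_assoc, LinearMap.comp_assoc, LinearMap.comp_assoc]
  rw [e, LinearMap.trace_conj']

/-- ★ **… hence ZERO when invariant functionals vanish** (e.g. colour multiplets, §1): `tr(T ∘ B c) = 0` for all `c`. [cite: Luscher1983, §3] -/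
theorem trace_comp_equivariant_eq_zero (α : G → C →ₗ[ℝ] C) (ρ : G → F ≃ₗ[ℝ] F) (T : F →ₗ[ℝ] F) (B : C →ₗ[ℝ] F →ₗ[ℝ] F)
    (hT : ∀ g, T ∘ₗ (ρ g : F →ₗ[ℝ] F) = (ρ g : F →ₗ[ℝ] F) ∘ₗ T)
    (hB : ∀ g c, B (α g c) = (ρ g : F →ₗ[ℝ] F) ∘ₗ B c ∘ₗ ((ρ g).symm : F →ₗ[ℝ] F))
    (hvan : ∀ ℓ : C →ₗ[ℝ] ℝ, (∀ g c, ℓ (α g c) = ℓ c) → ℓ = 0) (c : C) :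
    LinearMap.trace ℝ F (T ∘ₗ B c) = 0 := by
  set ℓ : C →ₗ[ℝ] ℝ := (LinearMap.trace ℝ F) ∘ₗ (LinearMap.llcomp ℝ F F F T) ∘ₗ B with hℓ
  have hℓapply : ∀ c', ℓ c' = LinearMap.trace ℝ F (T ∘ₗ B c') := fun c' => rfl
  have hinv : ∀ g c', ℓ (α g c') = ℓ c' := fun g c' => by
    rw [hℓapply, hℓapply]; exact trace_comp_equivariant_invariant α ρ T B hT hB g c'
  have := hvan ℓ hinv
  rw [← hℓapply, this, LinearMap.zero_apply]

end Trace

/-- ★ The colour instance: a linear, `Ad`-equivariant first-order perturbation `B : (ι → ℝ³) → End F` (constant gauge transformations acting by `ρ V` on the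
fluctuation space and by `Ad(V)` on the slow coordinate) has `tr(T ∘ B c) = 0` for every `T` commuting with the action. [cite: Luscher1983, §3] -/
theorem trace_comp_colourEquivariant_eq_zero {F : Type*} [AddCommGroup F] [Module ℝ F]
    (ρ : SU2 → F ≃ₗ[ℝ] F) (T : F →ₗ[ℝ] F) (B : (ι → Fin 3 → ℝ) →ₗ[ℝ] F →ₗ[ℝ] F)
    (hT : ∀ V, T ∘ₗ (ρ V : F →ₗ[ℝ] F) = (ρ V : F →ₗ[ℝ] F) ∘ₗ T)
    (hB : ∀ (V : SU2) (c : ι → Fin 3 → ℝ), B (fun i => (adRot V).mulVec (c i)) = (ρ V : F →ₗ[ℝ] F) ∘ₗ B c ∘ₗ ((ρ V).symm : F →ₗ[ℝ] F))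
    (c : ι → Fin 3 → ℝ) : LinearMap.trace ℝ F (T ∘ₗ B c) = 0 := by
  -- the colour rotation as a linear action on `ι → ℝ³`
  set α : SU2 → (ι → Fin 3 → ℝ) →ₗ[ℝ] (ι → Fin 3 → ℝ) := fun V =>
    { toFun := fun c i => (adRot V).mulVec (c i)
      map_add' := fun x y => by funext i; simp [Matrix.mulVec_add]
      map_smul' := fun r x => by funext i; simp [Matrix.mulVec_smul] } with hα
  have hαapply : ∀ V c', α V c' = fun i => (adRot V).mulVec (c' i) := fun V c' => rfl
  refine trace_comp_equivariant_eq_zero α ρ T B hT (fun V c' => by rw [hαapply]; exact hB V c') (fun ℓ hℓ => ?_) c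
  exact colourFunctional_eq_zero_of_adRot ℓ fun V c' => by rw [← hαapply]; exact hℓ V c'

/-! ## §3 `log det(1 + N)` is second order when `tr N = 0` -/

section LogDet

variable {m : Type*} [Fintype m] [DecidableEq m]

/-- Elementary: `1 − 1/μ ≥ (μ − 1) − 2(μ − 1)²` for `μ ≥ 1/2`. [folklore] -/
theorem sub_one_sub_two_sq_le_one_sub_inv {μ : ℝ} (hμ : 1 / 2 ≤ μ) : (μ - 1) - 2 * (μ - 1) ^ 2 ≤ 1 - μ⁻¹ := by
  have hμ0 : 0 < μ := by linarith
  rw [show 1 - μ⁻¹ = (μ - 1) / μ by field_simp]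
  rw [le_div_iff₀ hμ0]
  nlinarith [sq_nonneg (μ - 1)]

/-- Hence `(μ − 1) − 2(μ − 1)² ≤ log μ ≤ μ − 1` for `μ ≥ 1/2`. [folklore] -/
theorem log_two_sided_of_half_le {μ : ℝ} (hμ : 1 / 2 ≤ μ) : (μ - 1) - 2 * (μ - 1) ^ 2 ≤ Real.log μ ∧ Real.log μ ≤ μ - 1 := by
  have hμ0 : 0 < μ := by linarith
  exact ⟨(sub_one_sub_two_sq_le_one_sub_inv hμ).trans (Real.one_sub_inv_le_log_of_pos hμ0), Real.log_le_sub_one_of_pos hμ0⟩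

/-- The eigenvalues `μᵢ` of `1 + N` satisfy `|μᵢ − 1| ≤ κ` when `|⟨v,Nv⟩| ≤ κ‖v‖²` for all `v`. [cite: HornJohnson2013, Thm 4.1.5] -/
theorem abs_eigenvalues_one_add_sub_one_le {N : Matrix m m ℝ} (hN : N.IsHermitian) {κ : ℝ}
    (hq : ∀ v : m → ℝ, |v ⬝ᵥ (N *ᵥ v)| ≤ κ * (v ⬝ᵥ v)) (i : m) :
    |(Matrix.isHermitian_one.add hN).eigenvalues i - 1| ≤ κ := by
  set hB := Matrix.isHermitian_one.add hN
  set e : m → ℝ := ⇑(hB.eigenvectorBasis i) with he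
  have hev : (1 + N) *ᵥ e = hB.eigenvalues i • e := hB.mulVec_eigenvectorBasis i
  have hNe : N *ᵥ e = (hB.eigenvalues i - 1) • e := by
    rw [Matrix.add_mulVec, Matrix.one_mulVec] at hev
    rw [sub_smul, one_smul, ← hev]; abel
  have hee : e ⬝ᵥ e = 1 := by
    have h1 : ‖hB.eigenvectorBasis i‖ = 1 := hB.eigenvectorBasis.orthonormal.1 i
    have h2 := EuclideanSpace.real_norm_sq_eq (hB.eigenvectorBasis i)
    rw [h1, one_pow] at h2
    rw [h2, dotProduct]
    exact Finset.sum_congr rfl fun j _ => by rw [he, sq]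
  have h := hq e
  rw [hNe, dotProduct_smul, hee, smul_eq_mul, mul_one, mul_one] at h
  exact h

/-- ★★ **`log det(1+N)` to second order.**  For a real symmetric `N` with `|⟨v,Nv⟩| ≤ κ‖v‖²` (`κ ≤ ½`): `0 < det(1+N)`, `log det(1+N) ≤ tr N` and
`tr N − 2·|m|·κ² ≤ log det(1+N)`.  With `tr N = 0` (brick Y §2): `|log det(1+N)| ≤ 2|m|κ²`. [cite: HornJohnson2013, Thm 4.1.5] -/
theorem log_det_one_add_two_sided {N : Matrix m m ℝ} (hN : N.IsHermitian) {κ : ℝ} (hκ : κ ≤ 1 / 2)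
    (hq : ∀ v : m → ℝ, |v ⬝ᵥ (N *ᵥ v)| ≤ κ * (v ⬝ᵥ v)) :
    0 < (1 + N).det ∧ Real.log (1 + N).det ≤ N.trace ∧ N.trace - 2 * Fintype.card m * κ ^ 2 ≤ Real.log (1 + N).det := by
  set hB := Matrix.isHermitian_one.add hN
  set μ := hB.eigenvalues with hμ
  have hμb : ∀ i, |μ i - 1| ≤ κ := abs_eigenvalues_one_add_sub_one_le hN hq
  have hμhalf : ∀ i, 1 / 2 ≤ μ i := fun i => by
    have := (abs_le.mp (hμb i)).1; linarith
  have hμpos : ∀ i, 0 < μ i := fun i => lt_of_lt_of_le (by norm_num) (hμhalf i)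
  have hdet : (1 + N).det = ∏ i, μ i := by
    have := hB.det_eq_prod_eigenvalues
    simpa using this
  have htr : N.trace = ∑ i, (μ i - 1) := by
    have h1 : (1 + N).trace = ∑ i, μ i := by
      have := hB.trace_eq_sum_eigenvalues
      simpa using this
    rw [Matrix.trace_add, Matrix.trace_one] at h1
    rw [Finset.sum_sub_distrib, Finset.sum_const, Finset.card_univ, nsmul_eq_mul, mul_one]
    linarith
  have hdetpos : 0 < (1 + N).det := by rw [hdet]; exact Finset.prod_pos fun i _ => hμpos i
  have hlog : Real.log (1 + N).det = ∑ i, Real.log (μ i) := by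
    rw [hdet, Real.log_prod]
    exact fun i _ => (hμpos i).ne'
  refine ⟨hdetpos, ?_, ?_⟩
  · rw [hlog, htr]
    exact Finset.sum_le_sum fun i _ => (log_two_sided_of_half_le (hμhalf i)).2
  · rw [hlog, htr]
    have hsq : ∀ i, (μ i - 1) ^ 2 ≤ κ ^ 2 := fun i => by
      have := hμb i
      rw [← sq_abs]
      exact pow_le_pow_left₀ (abs_nonneg _) this 2
    calc ∑ i, (μ i - 1) - 2 * Fintype.card m * κ ^ 2 = ∑ i, ((μ i - 1) - 2 * κ ^ 2) := by
          rw [Finset.sum_sub_distrib (f := fun i => μ i - 1), Finset.sum_const, Finset.card_univ, nsmul_eq_mul]; ring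
      _ ≤ ∑ i, ((μ i - 1) - 2 * (μ i - 1) ^ 2) := Finset.sum_le_sum fun i _ => by linarith [hsq i]
      _ ≤ ∑ i, Real.log (μ i) := Finset.sum_le_sum fun i _ => (log_two_sided_of_half_le (hμhalf i)).1

/-- ★★ The form used downstream: `tr N = 0` ⇒ `|log det(1+N)| ≤ 2|m|κ²` (`κ ≤ ½`). [cite: HornJohnson2013, Thm 4.1.5] -/
theorem abs_log_det_one_add_le_of_trace_eq_zero {N : Matrix m m ℝ} (hN : N.IsHermitian) {κ : ℝ} (hκ : κ ≤ 1 / 2)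
    (hq : ∀ v : m → ℝ, |v ⬝ᵥ (N *ᵥ v)| ≤ κ * (v ⬝ᵥ v)) (htr : N.trace = 0) :
    |Real.log (1 + N).det| ≤ 2 * Fintype.card m * κ ^ 2 := by
  obtain ⟨-, h1, h2⟩ := log_det_one_add_two_sided hN hκ hq
  rw [htr] at h1 h2
  rw [abs_le]
  constructor <;> linarith

end LogDet

/-! ## §4 The congruence form: `log det(D + B) − log det D` is second order when `tr(D⁻¹B) = 0` (diagonal vacuum form) -/

section Congruence

variable {m : Type*} [Fintype m] [DecidableEq m]

/-- The normalised perturbation `N_{ij} = B_{ij}/√(dᵢ dⱼ)` of a diagonal positive form `D = diag d`. [folklore] -/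
theorem congruence_normalise {d : m → ℝ} (hd : ∀ i, 0 < d i) (B : Matrix m m ℝ) :
    Matrix.diagonal (fun i => Real.sqrt (d i)) * Matrix.of (fun i j => B i j / (Real.sqrt (d i) * Real.sqrt (d j))) *
        Matrix.diagonal (fun i => Real.sqrt (d i)) = B := by
  ext i j
  rw [Matrix.mul_diagonal, Matrix.diagonal_mul, Matrix.of_apply]
  have hi : Real.sqrt (d i) ≠ 0 := (Real.sqrt_pos.mpr (hd i)).ne'
  have hj : Real.sqrt (d j) ≠ 0 := (Real.sqrt_pos.mpr (hd j)).ne'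
  field_simp

/-- ★★ **Second order in the congruence form.**  `D = diag(d)`, `dᵢ > 0`; `B` real symmetric with `|vᵀBv| ≤ ε·vᵀDv` (`ε ≤ ½`) and
`Σᵢ Bᵢᵢ/dᵢ = tr(D⁻¹B) = 0` (brick Y §2: an `Ad`-equivariant first-order perturbation).  Then `0 < det(D + B)` and
`|log det(D + B) − log det D| ≤ 2|m|ε²` — the Gaussian determinant `∫e^{−⟨z,(D+B)z⟩} ∝ det(D+B)^{−1/2}` moves only at second order.
[cite: HornJohnson2013, Thm 4.1.5] -/
theorem abs_log_det_add_sub_log_det_le {d : m → ℝ} (hd : ∀ i, 0 < d i) {B : Matrix m m ℝ} (hB : B.IsHermitian) {ε : ℝ} (hε : ε ≤ 1 / 2)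
    (hq : ∀ v : m → ℝ, |v ⬝ᵥ (B *ᵥ v)| ≤ ε * ∑ i, d i * v i ^ 2) (htr : ∑ i, B i i / d i = 0) :
    0 < (Matrix.diagonal d + B).det ∧ |Real.log (Matrix.diagonal d + B).det - Real.log (Matrix.diagonal d).det| ≤ 2 * Fintype.card m * ε ^ 2 := by
  set r : m → ℝ := fun i => Real.sqrt (d i) with hr
  have hr0 : ∀ i, 0 < r i := fun i => Real.sqrt_pos.mpr (hd i)
  have hr2 : ∀ i, r i * r i = d i := fun i => Real.mul_self_sqrt (hd i).le
  set N : Matrix m m ℝ := Matrix.of fun i j => B i j / (r i * r j) with hN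
  -- `N` is symmetric
  have hNh : N.IsHermitian := by
    ext i j
    rw [Matrix.conjTranspose_apply, star_trivial, hN, Matrix.of_apply, Matrix.of_apply, mul_comm (r j)]
    congr 1
    have := hB.apply j i
    rw [star_trivial] at this
    exact this.symm
  -- `D + B = R (1 + N) R`, `R = diag r`
  have hfac : Matrix.diagonal d + B = Matrix.diagonal r * (1 + N) * Matrix.diagonal r := by
    rw [mul_add, add_mul, mul_one, Matrix.diagonal_mul_diagonal, congruence_normalise hd B]
    congr 1
    ext i j
    rw [Matrix.diagonal_apply, Matrix.diagonal_apply]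
    split_ifs with h
    · subst h; exact (hr2 i).symm
    · rfl
  have hdetR : (Matrix.diagonal r).det = ∏ i, r i := Matrix.det_diagonal
  have hdetR0 : 0 < (Matrix.diagonal r).det := by rw [hdetR]; exact Finset.prod_pos fun i _ => hr0 i
  have hdetD : (Matrix.diagonal d).det = ∏ i, d i := Matrix.det_diagonal
  have hdetD' : (Matrix.diagonal d).det = (Matrix.diagonal r).det * (Matrix.diagonal r).det := by
    rw [hdetD, hdetR, ← Finset.prod_mul_distrib]
    exact Finset.prod_congr rfl fun i _ => (hr2 i).symm
  have hdet : (Matrix.diagonal d + B).det = (Matrix.diagonal r).det * (1 + N).det * (Matrix.diagonal r).det := by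
    rw [hfac, Matrix.det_mul, Matrix.det_mul]
  -- the form bound and the trace of `N`
  have hqN : ∀ v : m → ℝ, |v ⬝ᵥ (N *ᵥ v)| ≤ ε * (v ⬝ᵥ v) := fun v => by
    set w : m → ℝ := fun i => v i / r i with hw
    have h1 : v ⬝ᵥ (N *ᵥ v) = w ⬝ᵥ (B *ᵥ w) := by
      simp only [dotProduct, Matrix.mulVec, hN, hw, Matrix.of_apply]
      refine Finset.sum_congr rfl fun i _ => ?_
      rw [div_mul_eq_mul_div, Finset.mul_sum, Finset.mul_sum, Finset.sum_div]
      refine Finset.sum_congr rfl fun j _ => ?_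
      have hi := (hr0 i).ne'
      have hj := (hr0 j).ne'
      field_simp
    have h2 : ∑ i, d i * w i ^ 2 = v ⬝ᵥ v := by
      simp only [dotProduct, hw]
      refine Finset.sum_congr rfl fun i _ => ?_
      have hi := (hr0 i).ne'
      rw [← hr2 i]
      field_simp
    rw [h1, ← h2]
    exact hq w
  have htrN : N.trace = 0 := by
    rw [Matrix.trace]
    simp only [Matrix.diag_apply, hN, Matrix.of_apply]
    rw [← htr]
    exact Finset.sum_congr rfl fun i _ => by rw [hr2 i]
  obtain ⟨hpos, -, -⟩ := log_det_one_add_two_sided hNh hε hqN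
  have habs := abs_log_det_one_add_le_of_trace_eq_zero hNh hε hqN htrN
  refine ⟨by rw [hdet]; exact mul_pos (mul_pos hdetR0 hpos) hdetR0, ?_⟩
  rw [hdet, hdetD', Real.log_mul (mul_pos hdetR0 hpos).ne' hdetR0.ne', Real.log_mul hdetR0.ne' hpos.ne', Real.log_mul hdetR0.ne' hdetR0.ne']
  have e : Real.log (Matrix.diagonal r).det + Real.log (1 + N).det + Real.log (Matrix.diagonal r).det -
      (Real.log (Matrix.diagonal r).det + Real.log (Matrix.diagonal r).det) = Real.log (1 + N).det := by ring
  rw [e]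
  exact habs

end Congruence

end Summit.QuantumFields.YangMills.Theorems.FemtoTransferGap.TwoLattice.Toron

end
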